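import Mathlib
import Literature.Analysis.ODE.InverseSquareTrueChainScaled
import Literature.Analysis.PDE.TruePolynomialKernel
import Literature.Analysis.PDE.Wave1DNonRadiating
import Literature.Analysis.PDE.TrueKernelElementLemmas
import HarnessLib

/-!
# The true non-radiative kernel elements of `ψ_tt − ψ_zz + P(z)ψ = 0` on `{z > 1+|t|}`

Analysis/PDE support file (everything proved). For a continuous potential `P ≥ 0` of inverse-square
type beyond `3/8` — `P z = n(n+1)/z² + q z`, `|q z| ≤ ε z^{-5/2}`, `ε ≤ 1/64` — and every model
datum `z^{γ₀}`, `γ₀ = 2j − n`, of position type (`π = 0`, `2j ≤ n`) or velocity type (`π = 1`,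
`2j + 1 ≤ n`), `exists_trueKernelElement` produces a global `C²` function `p` with:
`p_tt − p_zz + P p = 0` for `z ≥ 1`; `p` is a `t`-polynomial `Σ_{i<N} A_i(z) tⁱ` for `z ≥ 7/8`;
its data at `t = 0` on `z ≥ 1` are `((1−π) a₀, π a₀)` with `a₀` `ε`-close to `z^{γ₀}` in energy,
`∫_{z>1} (∂_z p(0) − (1−π)γ₀ z^{γ₀−1})² + P (p(0) − (1−π)z^{γ₀})² + (∂_t p(0) − π z^{γ₀})² ≤ K ε²`;
finite data energy; and NO channel energy: `∫_{z>1+|t|} e_P[p](t) → 0` as `t → ±∞`. Assembled from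
the true chains (`InverseSquareTrueChainScaled.lean`), the `t`-polynomial construction
(`TruePolynomialKernel.lean`) and the pointwise decay criterion (`Wave1DNonRadiating.lean`). These
span the comparison space `K_P` of the far-side channel estimate of `FixedModeChannels` (route
PhotonSphereChannels, stmt-FinalStateConjecture-10048); for `q = 0` they are the classical
non-radiative solutions (Kenig–Lawrie–Liu–Schlag 2015). Folklore.
-/

noncomputable section

namespace Literature.Analysis.PDE

open MeasureTheory Set Filter Topology Finset Real Literature.Analysis.ODE

/-- **True kernel elements.** See the module docstring. [folklore] -/
theorem exists_trueKernelElement (n : ℕ) {ν : ℕ} (hν : ν ≤ 1) {j : ℕ} (hj : 2 * j + ν ≤ n) :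
    ∃ K : ℝ, 0 ≤ K ∧ ∀ {P q : ℝ → ℝ} {ε : ℝ}, Continuous P → (∀ z, 0 ≤ P z) → Continuous q →
      0 ≤ ε → ε ≤ 1 / 64 → (∀ z, 3 / 8 ≤ z → P z = (n : ℝ) * (n + 1) / z ^ 2 + q z) →
      (∀ z, 3 / 8 ≤ z → |q z| ≤ ε * z ^ (-(5 : ℝ) / 2)) →
    ∃ p : ℝ → ℝ → ℝ, ContDiff ℝ 2 (Function.uncurry p) ∧
      (∀ t z, (1 : ℝ) ≤ z →
        iteratedDeriv 2 (fun τ => p τ z) t - iteratedDeriv 2 (p t) z + P z * p t z = 0) ∧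
      (∃ (N : ℕ) (A : ℕ → ℝ → ℝ), ∀ t z, (7 / 8 : ℝ) ≤ z →
        p t z = ∑ k ∈ range N, A k z * t ^ k) ∧
      IntegrableOn (fun z =>
          (deriv (p 0) z - (1 - ν) * ((2 * j : ℝ) - n) * z ^ ((2 * j : ℝ) - n - 1)) ^ 2
          + P z * (p 0 z - (1 - ν) * z ^ ((2 * j : ℝ) - n)) ^ 2
          + (deriv (fun τ => p τ z) 0 - ν * z ^ ((2 * j : ℝ) - n)) ^ 2) (Ioi 1) ∧
      (∫ z in Ioi 1, ((deriv (p 0) z - (1 - ν) * ((2 * j : ℝ) - n) * z ^ ((2 * j : ℝ) - n - 1)) ^ 2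
          + P z * (p 0 z - (1 - ν) * z ^ ((2 * j : ℝ) - n)) ^ 2
          + (deriv (fun τ => p τ z) 0 - ν * z ^ ((2 * j : ℝ) - n)) ^ 2)) ≤ K * ε ^ 2 ∧
      IntegrableOn (fun z => deriv (fun τ => p τ z) 0 ^ 2 + deriv (p 0) z ^ 2 + P z * p 0 z ^ 2)
          (Ioi 1) ∧
      (∀ t, IntegrableOn (fun z => deriv (fun τ => p τ z) t ^ 2 + deriv (p t) z ^ 2
          + P z * p t z ^ 2) (Ioi (1 + |t|))) ∧
      Tendsto (fun t => ∫ z in Ioi (1 + |t|),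
        (deriv (fun τ => p τ z) t ^ 2 + deriv (p t) z ^ 2 + P z * p t z ^ 2)) atTop (𝓝 0) ∧
      Tendsto (fun t => ∫ z in Ioi (1 + |t|),
        (deriv (fun τ => p τ z) t ^ 2 + deriv (p t) z ^ 2 + P z * p t z ^ 2)) atBot (𝓝 0) := by
  have hν01 := Nat.le_one_iff_eq_zero_or_eq_one.1 hν
  have hj' : 2 * j ≤ n := by omega
  obtain ⟨K, hK0, hK⟩ := exists_true_chain_scaled n
    (m := fun i => (((2 * i + ν + 1) * (2 * i + ν + 2) : ℕ) : ℝ)) (fun i => by positivity) hj'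
  refine ⟨K ^ 2 * ((n : ℝ) ^ 2 + n + 2), by positivity, ?_⟩
  intro P q ε hPc hP0 hq hε hε1 hPq hqb
  have hγ₀ : (2 * j : ℝ) - n ≤ 0 := by
    have : ((2 * j : ℕ) : ℝ) ≤ n := by exact_mod_cast hj'
    push_cast at this; linarith
  have hγ₁ : ν = 1 → (2 * j : ℝ) - n ≤ -1 := fun h => by
    subst h
    have : ((2 * j + 1 : ℕ) : ℝ) ≤ n := by exact_mod_cast hj
    push_cast at this; linarith
  have hγν : (2 * j : ℝ) - n + ν ≤ 0 := by
    have : ((2 * j + ν : ℕ) : ℝ) ≤ n := by exact_mod_cast hj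
    push_cast at this; linarith
  have hε1' : ε ≤ 1 := by linarith
  -- the potential on `z ≥ 1`
  have hPbd : ∀ z, 1 ≤ z → P z ≤ ((n : ℝ) ^ 2 + n + 1) * z ^ (-(2 : ℝ)) := by
    intro z hz
    have hz0 : 0 < z := by linarith
    have hq1 : q z ≤ z ^ (-(2 : ℝ)) := by
      have h1 := (le_abs_self _).trans (hqb z (by linarith))
      have h2 : z ^ (-(5 : ℝ) / 2) ≤ z ^ (-(2 : ℝ)) := rpow_le_rpow_of_exponent_le hz (by norm_num)
      have h3 : 0 ≤ z ^ (-(5 : ℝ) / 2) := rpow_nonneg hz0.le _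
      nlinarith
    have e : P z = ((n : ℝ) ^ 2 + n) * z ^ (-(2 : ℝ)) + q z := by
      rw [hPq z (by linarith), rpow_neg hz0.le, rpow_two]; ring
    rw [e]
    have : 0 ≤ z ^ (-(2 : ℝ)) := rpow_nonneg hz0.le _
    nlinarith
  -- the chains and the polynomial
  obtain ⟨a, a', c, hc0, htop, hcont, hder, hbd, hcK⟩ := hK hPc hq hε hε1 hPq hqb
  obtain ⟨p, hpC, hpform, hpeq, hpder⟩ := exists_truePolynomial (a := a) (a' := a') (j := j) hPc ν
    (by rcases hν01 with h | h <;> subst h <;> rfl) htop hcont hder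
  -- level-0 closeness and crude bounds on `z ≥ 1`
  have hbd0 : ∀ z, 1 ≤ z → |a 0 z - z ^ ((2 * j : ℝ) - n)| ≤ K * ε * z ^ ((2 * j : ℝ) - n - 1 / 2) ∧
      |a' 0 z - ((2 * j : ℝ) - n) * z ^ ((2 * j : ℝ) - n - 1)|
        ≤ K * ε * z ^ ((2 * j : ℝ) - n - 3 / 2) := by
    intro z hz
    have h := hbd 0 (Nat.zero_le _) z (by linarith)
    simp only [Nat.cast_zero, mul_zero, sub_zero, hc0, one_mul] at h
    exact h
  have hcr : ∀ i, i ≤ j → ∀ z, 1 ≤ z → |a i z| ≤ 2 * K * z ^ ((2 * j : ℝ) - n - 2 * i) ∧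
      |a' i z| ≤ ((2 * n + 1) + 1) * K * z ^ ((2 * j : ℝ) - n - 2 * i - 1) := by
    intro i hi z hz
    obtain ⟨h0, h1⟩ := hbd i hi z (by linarith)
    refine chain_crude_bounds (G := 2 * n + 1) hK0 hε1' (hcK i hi) ?_ hz h0 h1
    have h1 : (i : ℝ) ≤ j := by exact_mod_cast hi
    have h2 : (0 : ℝ) ≤ i := Nat.cast_nonneg _
    have h3 : (0 : ℝ) ≤ n := Nat.cast_nonneg _
    have hlo : -(2 * (n : ℝ) + 1) ≤ (2 * j : ℝ) - n - 2 * i := by linarith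
    have hhi : (2 * j : ℝ) - n - 2 * i ≤ 2 * (n : ℝ) + 1 := by linarith
    exact abs_le.2 ⟨hlo, hhi⟩
  -- pointwise energy decay on the far region
  have hL : 0 ≤ (2 * n + 2) * K := by positivity
  have hdecay := truePoly_energy_pointwise (W := P) (p := p) (a := a) (a' := a') (j := j) (ν := ν)
    (n := n) (γ₀ := (2 * j : ℝ) - n) (L := (2 * n + 2) * K) hL hγν (by omega) hPbd hpform
    (fun t z hz => (hpder t z hz).1) (fun t z hz => (hpder t z hz).2)
    (fun i hi z hz => ((hcr i hi z hz).1).trans (by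
      have : 0 ≤ z ^ ((2 * j : ℝ) - n - 2 * i) := rpow_nonneg (by linarith) _
      have h3 : (0 : ℝ) ≤ n := Nat.cast_nonneg _
      exact mul_le_mul_of_nonneg_right (by nlinarith) this))
    (fun i hi z hz => ((hcr i hi z hz).2).trans (le_of_eq (by ring)))
  obtain ⟨hint, -, hlimtop, hlimbot⟩ := wave1D_farEnergy_tendsto_zero hPc hP0 hpC hdecay
  -- data at `t = 0` on `z ≥ 1`
  have hp0 : ∀ z, 1 ≤ z → p 0 z = (1 - ν) * a 0 z := fun z hz => by
    rw [hpform 0 z (by linarith)]; exact sum_zero_pow_parity (fun i => a i z) j hν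
  have hpz0 : ∀ z, 1 ≤ z → deriv (p 0) z = (1 - ν) * a' 0 z := fun z hz => by
    rw [(hpder 0 z hz).2]; exact sum_zero_pow_parity (fun i => a' i z) j hν
  have hpt0 : ∀ z, 1 ≤ z → deriv (fun τ => p τ z) 0 = ν * a 0 z := fun z hz => by
    rw [(hpder 0 z hz).1]; exact sum_zero_pow_parity_deriv (fun i => a i z) j hν
  -- the closeness integrand, explicit version on `Ioi 1`
  set Iex : ℝ → ℝ := fun z => ((1 - ν) * a' 0 z - (1 - ν) * ((2 * j : ℝ) - n)
      * z ^ ((2 * j : ℝ) - n - 1)) ^ 2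
      + P z * ((1 - ν) * a 0 z - (1 - ν) * z ^ ((2 * j : ℝ) - n)) ^ 2
      + (ν * a 0 z - ν * z ^ ((2 * j : ℝ) - n)) ^ 2 with hIex
  have hIex_bd : ∀ z, 1 ≤ z → Iex z ≤ K ^ 2 * ((n : ℝ) ^ 2 + n + 2) * ε ^ 2 * z ^ (-(3 : ℝ)) := by
    intro z hz
    obtain ⟨d0, d1⟩ := hbd0 z hz
    have h := trueKernel_closeness_pointwise (n := n) hν hγ₀ hγ₁ hz d0 d1 (hPbd z hz)
    simp only [hIex]
    convert h using 2
  have hIex_nn : ∀ z, 0 ≤ Iex z := fun z => by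
    simp only [hIex]; have := hP0 z; positivity
  have ha'c : ContinuousOn (a' 0) (Ioi (1 / 2)) := fun z hz =>
    ((hder 0 (Nat.zero_le _) z hz).2.continuousAt).continuousWithinAt
  have hrpc : ∀ e : ℝ, ContinuousOn (fun z : ℝ => z ^ e) (Ioi 1) := fun e z hz =>
    (continuousAt_rpow_const _ _ (Or.inl (by
      have := Set.mem_Ioi.1 hz; linarith))).continuousWithinAt
  have hIex_c : ContinuousOn Iex (Ioi 1) := by
    have h1 : ContinuousOn (a' 0) (Ioi 1) := ha'c.mono (Ioi_subset_Ioi (by norm_num))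
    have h0 : ContinuousOn (a 0) (Ioi 1) := (hcont 0 (Nat.zero_le _)).continuousOn
    simp only [hIex]
    exact ((((continuousOn_const.mul h1).sub ((continuousOn_const.mul continuousOn_const).mul
      (hrpc _))).pow 2).add (hPc.continuousOn.mul (((continuousOn_const.mul h0).sub
      (continuousOn_const.mul (hrpc _))).pow 2))).add
      (((continuousOn_const.mul h0).sub (continuousOn_const.mul (hrpc _))).pow 2)
  have hIex_int : IntegrableOn Iex (Ioi 1) :=
    Integrable.mono' ((integrableOn_Ioi_rpow_of_lt (by norm_num : (-(3 : ℝ)) < -1)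
      zero_lt_one).const_mul (K ^ 2 * ((n : ℝ) ^ 2 + n + 2) * ε ^ 2))
      (hIex_c.aestronglyMeasurable measurableSet_Ioi)
      ((ae_restrict_iff' measurableSet_Ioi).2 (ae_of_all _ fun z hz => by
        rw [Real.norm_eq_abs, abs_of_nonneg (hIex_nn z)]; exact hIex_bd z (le_of_lt hz)))
  have hIeq : ∀ z ∈ Ioi (1 : ℝ), (deriv (p 0) z - (1 - ν) * ((2 * j : ℝ) - n)
      * z ^ ((2 * j : ℝ) - n - 1)) ^ 2 + P z * (p 0 z - (1 - ν) * z ^ ((2 * j : ℝ) - n)) ^ 2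
      + (deriv (fun τ => p τ z) 0 - ν * z ^ ((2 * j : ℝ) - n)) ^ 2 = Iex z := by
    intro z hz
    have hz' : (1 : ℝ) ≤ z := le_of_lt hz
    simp only [hIex, hp0 z hz', hpz0 z hz', hpt0 z hz']
  -- the data energy density, explicit version on `Ioi 1`
  have hE0_bd : ∀ z, 1 ≤ z → deriv (fun τ => p τ z) 0 ^ 2 + deriv (p 0) z ^ 2 + P z * p 0 z ^ 2
      ≤ ((2 * K) ^ 2 + ((2 * n + 2) * K) ^ 2 + ((n : ℝ) ^ 2 + n + 1) * (2 * K) ^ 2)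
        * z ^ (-(2 : ℝ)) := by
    intro z hz
    obtain ⟨b0, b1⟩ := hcr 0 (Nat.zero_le _) z hz
    simp only [Nat.cast_zero, mul_zero, sub_zero] at b0 b1
    rw [hpt0 z hz, hpz0 z hz, hp0 z hz]
    exact trueKernel_energy_pointwise0 (n := n) hν hK0 hγ₀ hγ₁ hz b0
      (b1.trans (le_of_eq (by ring))) (hPbd z hz)
  have hE0_c : Continuous fun z => deriv (fun τ => p τ z) 0 ^ 2 + deriv (p 0) z ^ 2
      + P z * p 0 z ^ 2 :=
    (continuous_wave1D_energyDensity hPc hpC).comp (continuous_const.prodMk continuous_id)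
  have hE0_int : IntegrableOn (fun z => deriv (fun τ => p τ z) 0 ^ 2 + deriv (p 0) z ^ 2
      + P z * p 0 z ^ 2) (Ioi 1) :=
    Integrable.mono' ((integrableOn_Ioi_rpow_of_lt (by norm_num : (-(2 : ℝ)) < -1)
      zero_lt_one).const_mul _) hE0_c.aestronglyMeasurable
      ((ae_restrict_iff' measurableSet_Ioi).2 (ae_of_all _ fun z hz => by
        rw [Real.norm_eq_abs, abs_of_nonneg (wave1D_energyDensity_nonneg hP0 0 z)]
        exact hE0_bd z (le_of_lt hz)))
  -- assemble
  refine ⟨p, hpC, hpeq,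
    ⟨2 * j + ν + 1, fun k z => ∑ i ∈ range (j + 1), if 2 * i + ν = k then a i z else 0,
      fun t z hz => (hpform t z hz).trans (sum_parity_monomials_eq (fun i => a i z) j ν t)⟩,
    (hIex_int.congr_fun (fun z hz => (hIeq z hz).symm) measurableSet_Ioi), ?_, hE0_int,
    hint, hlimtop, hlimbot⟩
  rw [setIntegral_congr_fun measurableSet_Ioi hIeq]
  calc (∫ z in Ioi 1, Iex z)
      ≤ ∫ z in Ioi (1:ℝ), K ^ 2 * ((n : ℝ) ^ 2 + n + 2) * ε ^ 2 * z ^ (-(3 : ℝ)) :=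
        setIntegral_mono_on hIex_int ((integrableOn_Ioi_rpow_of_lt (by norm_num : (-(3 : ℝ)) < -1)
          zero_lt_one).const_mul _) measurableSet_Ioi fun z hz => hIex_bd z (le_of_lt hz)
    _ = K ^ 2 * ((n : ℝ) ^ 2 + n + 2) * ε ^ 2 * (1 / 2) := by
        rw [MeasureTheory.integral_const_mul,
          integral_Ioi_rpow_of_lt (by norm_num : (-(3 : ℝ)) < -1) zero_lt_one]
        norm_num
    _ ≤ K ^ 2 * ((n : ℝ) ^ 2 + n + 2) * ε ^ 2 := by
        have : 0 ≤ K ^ 2 * ((n : ℝ) ^ 2 + n + 2) * ε ^ 2 := by positivity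
        nlinarith

end Literature.Analysis.PDE
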